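import Mathlib
import Summits.ResolutionOfSingularities.ResolutionOfSingularities.Theorems.HomologicalConductorPersistenceGradedTransfer
import Summits.ResolutionOfSingularities.ResolutionOfSingularities.Theorems.HomologicalConductorPersistenceCyclicTransferCoinduced
import Summits.ResolutionOfSingularities.ResolutionOfSingularities.Theorems.HomologicalConductorPersistenceCyclicTransferSyzygy
import HarnessLib

/-!
# Rung S-2 `PersistenceSurface` (stmt-ResolutionOfSingularities-19970) — the REYNOLDS-FREE TRANSFER, coinduced form:
# `𝔞 · caⁿ⁺¹(V) ⊆ caⁿ⁺¹(U)` for a finitely GRADED `V ⊇ U = V₀` (no `|G| ∈ Uˣ`, no root of unity), at level `ca³` under the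
# Frobenius hypothesis — the T-V floor of stub-4's parts 4/5/10 for ALL characteristics

Route `ResolutionOfSingularities/HomologicalConductor`, chain W4.4b (cell res-hironaka; seat res-L1-w44b-stub-1 gen 6).
`[OURS · L1 w44b]` replaces the role of no printed item; NOT a statement of the manuscript under review (Hironaka
2017), nothing here is attributed to its author; folklore algebra, AI-written (weaker than expert review).

## Content

`U → V` commutative, `V = ⊕_{x ∈ G} V_x` a finite grading by `U`-linear projectors `eₓ` (`∑ eₓ = id`,
`eₓ e_y = δ e_y`, `V_x V_y ⊆ V_{x+y}`) with degree-`0` part realised by a `U`-linear `ρ : V → U`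
(`algebraMap (ρ v) = e₀ v`, `ρ 1 = 1`).  For ANY `U`-module `N` the coextension `H = Hom_U(V, N)` (Mathlib's
`ModuleCat.CoextendScalars` structure `(w • φ) v = φ(v w)`) carries the `U`-linear maps `j : N → H`,
`j n = (v ↦ ρ(v) • n)` and `q : H → N`, `q φ = φ 1`, with `q ∘ j = id` — NO averaging, NO invariants
(`exists_coinduced_retract`).  Hence (`…PersistenceGradedTransfer.StablyAnnihilates.of_graded`):

* `StablyAnnihilates.of_coinduced_graded` — `c` stably annihilates `Hom_U(V, N)` over `V`, `a = ∑ₖ bₖ b′ₖ` with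
  `b′ₖ ∈ V_{−x}` for every `x`, `algebraMap u = a c` ⇒ `u` stably annihilates `N` over `U`;
* `mul_mem_cohomologyAnnihilatorOfDegree_of_coinduced_syzygy_graded` — level `n + 1` modulo the syzygy input
  («`Hom_U(V, K)` of an `n`-th syzygy is an `n`-th syzygy»);
* **`mul_mem_cohomologyAnnihilatorOfDegree_three_graded`**, `mul_mem_cohomologyAnnihilator_graded` — level `ca³`
  under the FROBENIUS HYPOTHESIS `Hom_U(V, U)` finitely generated projective over `V` (stub-4's group-free
  `PersistenceCyclicTransferSyzygy.exists_isSyzygy_two_coind`, p5xxxxx; dischargeable from ANY perfect pairing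
  `φ = ρ(· w)` by `finite_projective_of_reynoldsPairing`): `U`, `V` noetherian, `c ∈ ca³(V)`,
  `a ∈ ⋂ₓ V_x V_{−x}` (decomposition data), `algebraMap u = a c` ⇒ **`u ∈ ca³(U)`**.

This is stub-4's `mul_mem_cohomologyAnnihilatorOfDegree_three_group` (part 10) with the finite group, the characters,
`|G| ∈ Uˣ` and the primitive root REMOVED — the form the cyclic arrivals `1/n(1,q)` with `p ∣ n` need (K-PCC F5/F6,
res-L1-w44b-tri-2 TRIAGE v18 R67); the instantiation at `k[u,v] ⊃ k[u,v]^{(n,q)}` (weight grading `i + qj mod n`,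
perfect pairing) is the next file.

References (mechanism only): S. B. Iyengar, R. Takahashi, IMRN 2016, arXiv:1404.1476, Remark 2.13
[`IyengarTakahashi2014`]; M. Auslander, Trans. AMS 293 (1986).
-/

noncomputable section

-- single-problem summit: the doubled namespace component `ResolutionOfSingularities` is forced
set_option linter.dupNamespace false

namespace Summit.ResolutionOfSingularities.ResolutionOfSingularities.Theorems.HomologicalConductor.PersistenceGradedTransfer

open Finset CategoryTheory Literature.RingTheory.CohomologyAnnihilator
open Summit.ResolutionOfSingularities.ResolutionOfSingularities.Theorems.NoZeno.SandwichCluster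
open Summit.ResolutionOfSingularities.ResolutionOfSingularities.Theorems.HomologicalConductor.PersistenceCyclicTransferCoinduced
open Summit.ResolutionOfSingularities.ResolutionOfSingularities.Theorems.HomologicalConductor.PersistenceCyclicTransferSyzygy

universe u

variable {U V : Type u} [CommRing U] [CommRing V] [Algebra U V]

/-! ## The coinduced retract, without averaging -/

/-- **The coinduced retract.**  For a `U`-linear `ρ : V → U` with `ρ 1 = 1` and any `U`-module `N`, the maps
`j : N → Hom_U(V, N)`, `j n = (v ↦ ρ(v) • n)`, and `q : Hom_U(V, N) → N`, `q φ = φ 1`, are `U`-linear (for the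
pointwise / coextended structure) and `q ∘ j = id`. [folklore] -/
theorem exists_coinduced_retract (ρ : V →ₗ[U] U) (hρ1 : ρ 1 = 1) (N : Type u) [AddCommGroup N] [Module U N] :
    ∃ (j : N →ₗ[U] (((ModuleCat.restrictScalars (algebraMap U V)).obj (ModuleCat.of V V)) →ₗ[U] N))
      (q : (((ModuleCat.restrictScalars (algebraMap U V)).obj (ModuleCat.of V V)) →ₗ[U] N) →ₗ[U] N),
      (∀ n, q (j n) = n) ∧ (∀ n (v : V), j n v = ρ v • n) ∧ ∀ φ, q φ = φ (1 : V) := by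
  let ofW : ((ModuleCat.restrictScalars (algebraMap U V)).obj (ModuleCat.of V V)) → V := fun w => w
  let toW : V → ((ModuleCat.restrictScalars (algebraMap U V)).obj (ModuleCat.of V V)) := fun v => v
  let j : N →ₗ[U] (((ModuleCat.restrictScalars (algebraMap U V)).obj (ModuleCat.of V V)) →ₗ[U] N) :=
    { toFun := fun n =>
        { toFun := fun v => ρ (ofW v) • n
          map_add' := fun v v' => by
            change ρ (ofW v + ofW v') • n = _
            rw [map_add, add_smul]
          map_smul' := fun r v => by
            change ρ (algebraMap U V r * ofW v) • n = r • (ρ (ofW v) • n)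
            rw [← Algebra.smul_def, map_smul, smul_eq_mul, mul_smul] }
      map_add' := fun n n' => by
        apply LinearMap.ext; intro v
        change ρ (ofW v) • (n + n') = ρ (ofW v) • n + ρ (ofW v) • n'
        rw [smul_add]
      map_smul' := fun r n => by
        apply LinearMap.ext; intro v
        change ρ (ofW v) • (r • n) = r • (ρ (ofW v) • n)
        rw [smul_comm] }
  let q : (((ModuleCat.restrictScalars (algebraMap U V)).obj (ModuleCat.of V V)) →ₗ[U] N) →ₗ[U] N :=
    { toFun := fun φ => φ (toW 1)
      map_add' := fun φ φ' => rfl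
      map_smul' := fun r φ => rfl }
  refine ⟨j, q, fun n => ?_, fun n v => rfl, fun φ => rfl⟩
  change ρ (ofW (toW 1)) • n = n
  change ρ 1 • n = n
  rw [hρ1, one_smul]

/-! ## Transfer for the coinduced module -/

variable {G : Type*} [AddCommGroup G] [Fintype G] [DecidableEq G]

/-- **GRADED TRANSFER, coinduced form.**  With the grading data of `…PersistenceGradedTransfer` (`eₓ`, `ρ`,
`ρ 1 = 1`): if `c` stably annihilates `Hom_U(V, N)` over `V` and `a = ∑ₖ bₖ b′ₖ` with `b′ₖ ∈ V_{−x}` for every `x`,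
then `u` with `algebraMap u = a c` stably annihilates `N` over `U`. [this work] -/
theorem StablyAnnihilates.of_coinduced_graded (e : G → (V →ₗ[U] V)) (he_sum : ∀ w, ∑ x, e x w = w)
    (he_proj : ∀ x y w, e x (e y w) = if x = y then e y w else 0)
    (he_mul : ∀ x y (v w : V), e x v = v → e y w = w → e (x + y) (v * w) = v * w)
    (ρ : V →ₗ[U] U) (hρ : ∀ v, algebraMap U V (ρ v) = e 0 v) (hρ1 : ρ 1 = 1) {a : V} (n : G → ℕ)
    (b b' : (x : G) → Fin (n x) → V) (hb' : ∀ x k, e (-x) (b' x k) = b' x k) (hsum : ∀ x, ∑ k, b x k * b' x k = a)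
    (N : Type u) [AddCommGroup N] [Module U N] {c : V}
    (hc : StablyAnnihilates V c
      (ModuleCat.of V (((ModuleCat.restrictScalars (algebraMap U V)).obj (ModuleCat.of V V)) →ₗ[U] N)))
    (u : U) (hu : algebraMap U V u = a * c) : StablyAnnihilates U u (ModuleCat.of U N) := by
  haveI := isScalarTower_coinduced (U := U) (V := V) N
  obtain ⟨j, q, hqj, -, -⟩ := exists_coinduced_retract ρ hρ1 N
  exact StablyAnnihilates.of_graded e he_sum he_proj he_mul ρ hρ n b b' hb' hsum j q hqj hc u hu

/-- **Graded transfer at level `n + 1`, modulo the syzygy input.**  `U`, `V` noetherian; suppose the coextension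
`Hom_U(V, K)` of every `n`-th syzygy `K` of a finitely generated `U`-module is an `n`-th syzygy of a finitely
generated `V`-module.  Then `c ∈ caⁿ⁺¹(V)`, `a ∈ ⋂ₓ V_x V_{−x}` (decompositions) and `algebraMap u = a c` give
`u ∈ caⁿ⁺¹(U)`. [this work] -/
theorem mul_mem_cohomologyAnnihilatorOfDegree_of_coinduced_syzygy_graded [IsNoetherianRing U] [IsNoetherianRing V]
    (e : G → (V →ₗ[U] V)) (he_sum : ∀ w, ∑ x, e x w = w)
    (he_proj : ∀ x y w, e x (e y w) = if x = y then e y w else 0)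
    (he_mul : ∀ x y (v w : V), e x v = v → e y w = w → e (x + y) (v * w) = v * w)
    (ρ : V →ₗ[U] U) (hρ : ∀ v, algebraMap U V (ρ v) = e 0 v) (hρ1 : ρ 1 = 1) (m : ℕ)
    (hcoind : ∀ (X K : ModuleCat.{u} U), Module.Finite U X → IsSyzygy m X K →
      ∃ X' : ModuleCat.{u} V, Module.Finite V X' ∧ IsSyzygy m X'
        (ModuleCat.of V (((ModuleCat.restrictScalars (algebraMap U V)).obj (ModuleCat.of V V)) →ₗ[U] K)))
    {c : V} (hcn : c ∈ cohomologyAnnihilatorOfDegree V (m + 1)) {a : V} (n : G → ℕ)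
    (b b' : (x : G) → Fin (n x) → V) (hb' : ∀ x k, e (-x) (b' x k) = b' x k) (hsum : ∀ x, ∑ k, b x k * b' x k = a)
    (u : U) (hu : algebraMap U V u = a * c) : u ∈ cohomologyAnnihilatorOfDegree U (m + 1) := by
  refine (mem_cohomologyAnnihilatorOfDegree_succ_iff_forall_isSyzygy u).mpr fun X K hX hK => ?_
  obtain ⟨X', hX', hK'⟩ := hcoind X K hX hK
  have hcK := (mem_cohomologyAnnihilatorOfDegree_succ_iff_forall_isSyzygy c).mp hcn X' _ hX' hK'
  exact StablyAnnihilates.of_coinduced_graded e he_sum he_proj he_mul ρ hρ hρ1 n b b' hb' hsum K hcK u hu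

/-- **GRADED TRANSFER AT LEVEL `ca³` under the FROBENIUS HYPOTHESIS** (`Hom_U(V, U)` finitely generated projective
over `V`; stub-4's group-free `exists_isSyzygy_two_coind`).  `U`, `V` noetherian, `V = ⊕ₓ V_x` finitely graded over
`U = V₀` (projectors `eₓ`, degree-`0` part `ρ` with `ρ 1 = 1`), `c ∈ ca³(V)`, `a = ∑ₖ bₖ b′ₖ` with `b′ₖ ∈ V_{−x}` for
every `x`, `algebraMap u = a c` ⇒ **`u ∈ ca³(U)`** — with NO `|G| ∈ Uˣ` and NO root of unity. [this work] -/
theorem mul_mem_cohomologyAnnihilatorOfDegree_three_graded [IsNoetherianRing U] [IsNoetherianRing V]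
    [Module.Finite V (((ModuleCat.restrictScalars (algebraMap U V)).obj (ModuleCat.of V V)) →ₗ[U] U)]
    [Module.Projective V (((ModuleCat.restrictScalars (algebraMap U V)).obj (ModuleCat.of V V)) →ₗ[U] U)]
    (e : G → (V →ₗ[U] V)) (he_sum : ∀ w, ∑ x, e x w = w)
    (he_proj : ∀ x y w, e x (e y w) = if x = y then e y w else 0)
    (he_mul : ∀ x y (v w : V), e x v = v → e y w = w → e (x + y) (v * w) = v * w)
    (ρ : V →ₗ[U] U) (hρ : ∀ v, algebraMap U V (ρ v) = e 0 v) (hρ1 : ρ 1 = 1)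
    {c : V} (hc3 : c ∈ cohomologyAnnihilatorOfDegree V 3) {a : V} (n : G → ℕ)
    (b b' : (x : G) → Fin (n x) → V) (hb' : ∀ x k, e (-x) (b' x k) = b' x k) (hsum : ∀ x, ∑ k, b x k * b' x k = a)
    (u : U) (hu : algebraMap U V u = a * c) : u ∈ cohomologyAnnihilatorOfDegree U 3 :=
  mul_mem_cohomologyAnnihilatorOfDegree_of_coinduced_syzygy_graded e he_sum he_proj he_mul ρ hρ hρ1 2
    (fun X K hX hK => exists_isSyzygy_two_coind X K hX hK) hc3 n b b' hb' hsum u hu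

/-- **The same, `ca`-form.** [this work] -/
theorem mul_mem_cohomologyAnnihilator_graded [IsNoetherianRing U] [IsNoetherianRing V]
    [Module.Finite V (((ModuleCat.restrictScalars (algebraMap U V)).obj (ModuleCat.of V V)) →ₗ[U] U)]
    [Module.Projective V (((ModuleCat.restrictScalars (algebraMap U V)).obj (ModuleCat.of V V)) →ₗ[U] U)]
    (e : G → (V →ₗ[U] V)) (he_sum : ∀ w, ∑ x, e x w = w)
    (he_proj : ∀ x y w, e x (e y w) = if x = y then e y w else 0)
    (he_mul : ∀ x y (v w : V), e x v = v → e y w = w → e (x + y) (v * w) = v * w)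
    (ρ : V →ₗ[U] U) (hρ : ∀ v, algebraMap U V (ρ v) = e 0 v) (hρ1 : ρ 1 = 1)
    {c : V} (hc3 : c ∈ cohomologyAnnihilatorOfDegree V 3) {a : V} (n : G → ℕ)
    (b b' : (x : G) → Fin (n x) → V) (hb' : ∀ x k, e (-x) (b' x k) = b' x k) (hsum : ∀ x, ∑ k, b x k * b' x k = a)
    (u : U) (hu : algebraMap U V u = a * c) : u ∈ cohomologyAnnihilator U :=
  cohomologyAnnihilatorOfDegree_le (R := U) 3
    (mul_mem_cohomologyAnnihilatorOfDegree_three_graded e he_sum he_proj he_mul ρ hρ hρ1 hc3 n b b' hb' hsum u hu)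

end Summit.ResolutionOfSingularities.ResolutionOfSingularities.Theorems.HomologicalConductor.PersistenceGradedTransfer

end
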